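import Summits.AtomisticToContinuum.FouriersLaw.Theorems.HiddenChargeMazurOddChargeAlgebraToolkitB
import Summits.AtomisticToContinuum.FouriersLaw.Theorems.HiddenChargeMazurOddChargeAlgebraCore1
import Summits.AtomisticToContinuum.FouriersLaw.Theorems.HiddenChargeMazurOddChargeAlgebraCore2

/-!
# Odd conservation laws of the pinned anharmonic chain — core recursion: small spans and assembly

File CORE3 of the negative edge of crux `HiddenChargeMazur.OddChargeExists`
(item stmt-AtomisticToContinuum-13511): the spans `D = 2`, `D = 3` of the core clash, and the
assembly of `core_clash` for all `D ≥ 1` from the transport recursion (`core_step_one`,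
`core_step_two`, `core_step_generic`, `core_step_last`) and the clash `core_clash_of_last`.
Elementary polynomial algebra in `MvPolynomial (ℤ ⊕ ℤ) ℝ`. [folklore]
-/

noncomputable section

open MvPolynomial Finsupp
open scoped BigOperators

namespace Summit.AtomisticToContinuum.FouriersLaw.Theorems.OddChargeAlgebra

/-! ### Local toolkit -/

/-- `∂_{q_i} q_j = 0` for `j ≠ i`. [folklore] -/
private theorem pd_X_ne {i j : ℤ} (h : j ≠ i) : pderiv (Sum.inl i) (X (Sum.inl j) : R) = 0 :=
  pderiv_inl_X_inl_of_ne (Ne.symm h)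

/-- Chain rule for `cub`. [folklore] -/
private theorem pd_cub (v : Var) (a b : R) :
    pderiv v (cub a b) = (3 * a ^ 2 - 6 * a * b + 3 * b ^ 2) * pderiv v a
      + (6 * a * b - 3 * a ^ 2) * pderiv v b := by
  unfold cub
  simp only [map_add, map_sub, pderiv_mul, pderiv_pow, pderiv_ofNat]
  push_cast
  ring

/-- `∂_{q_{j+1}} γ_j = -1`. [folklore] -/
private theorem pd_gam_succ {i j : ℤ} (h : i = j + 1) : pderiv (Sum.inl i) (gam j) = -1 := by
  subst h
  exact pderiv_inl_gam_succ j

/-- `∂_{q_i} γ_j = 0` for `i ∉ {j, j+1}`. [folklore] -/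
private theorem pd_gam_ne {i j : ℤ} (h1 : j ≠ i) (h2 : j + 1 ≠ i) :
    pderiv (Sum.inl i) (gam j) = 0 :=
  pderiv_inl_gam_of_ne (Ne.symm h1) (Ne.symm h2)

/-- Splitting off the bottom factor of `prodsq (Ico a b)`. [folklore] -/
private theorem prodsq_Ico_bot {a b : ℤ} (h : a < b) :
    prodsq (Finset.Ico a b) = gam a ^ 2 * prodsq (Finset.Ico (a + 1) b) := by
  rw [← Finset.insert_Ico_add_one_left_eq_Ico h, prodsq_insert (by simp)]

/-- Integration tool: equal `∂_v`-derivatives and equal restrictions to `X v = 0` force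
equality. [folklore] -/
private theorem eq_of_pderiv_eq_of_killVar_eq {v : Var} {P Q : R}
    (h1 : pderiv v P = pderiv v Q) (h2 : killVar v P = killVar v Q) : P = Q :=
  sub_eq_zero.mp (eq_zero_of_pderiv_of_killVar (by rw [map_sub, h1, sub_self])
    (by rw [map_sub, h2, sub_self]))

/-! ### Span two -/

/-- `prodsq (Ico a (a+1)) = γ_a²`. [folklore] -/
private theorem prodsq_Ico_one (a : ℤ) : prodsq (Finset.Ico a (a + 1)) = gam a ^ 2 := by
  rw [prodsq_Ico_succ le_rfl, Finset.Ico_self, prodsq_empty, one_mul]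

/-- `prodsq (Ico 0 1) = γ_0²`. [folklore] -/
private theorem prodsq_01 : prodsq (Finset.Ico 0 1) = gam 0 ^ 2 := by
  have h := prodsq_Ico_one 0
  rwa [zero_add] at h

/-- `prodsq (Ico 1 2) = γ_1²`. [folklore] -/
private theorem prodsq_12 : prodsq (Finset.Ico 1 2) = gam 1 ^ 2 := by
  have h := prodsq_Ico_one 1
  norm_num at h
  exact h

/-- Span `D = 2`: `(★)_1` and the boundary condition force `a_1`, then `(★)_2` fails unless
`c = 0` (residual `4c·Φ_L·γ_1·q_3·clashQuad 2`). [folklore] -/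
theorem core_clash_two : ∀ (c : ℝ) (a : ℤ → R),
    (∀ y, a y ∈ supported ℝ (Sum.inl '' Set.Icc (0 : ℤ) 2)) → (∀ y, y < 0 ∨ 2 < y → a y = 0) →
    a 0 = C c * lead0 2 → a 2 = C c * leadD 2 →
    (∀ y : ℤ, cub (X (Sum.inl 0)) (X (Sum.inl 1)) * shift (pderiv (Sum.inl 0) (a (y - 1))
      + pderiv (Sum.inl (y - 1)) (a 0)) = cub (X (Sum.inl (2 + 1))) (X (Sum.inl 2))
      * (pderiv (Sum.inl 2) (a y) + pderiv (Sum.inl y) (a 2))) →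
    (∀ y, y ≤ 2 - 1 → killVar (Sum.inl 2) (a y) = 0) → c = 0 := by
  intro c a _ _ h0 h2 hstar hkill
  have l0 : a 0 = C c * (cub (X (Sum.inl 2)) (X (Sum.inl 1)) * gam 0 ^ 2) := by
    rw [h0, lead0]
    simp only [show (2 : ℤ) - 1 = 1 by omega, prodsq_01]
  have l2 : a 2 = C c * -(cub (X (Sum.inl 0)) (X (Sum.inl 1)) * gam 1 ^ 2) := by
    rw [h2, leadD, prodsq_12]
  -- the transport equation `(★)_1` determines `∂_2 a_1`
  have s1 := hstar 1
  simp only [sub_self, show (2 : ℤ) + 1 = 3 by omega, l0, l2] at s1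
  simp only [pderiv_mul, pderiv_C, map_neg, pderiv_pow, pd_cub, pderiv_X_self,
    pd_X_ne (show (1 : ℤ) ≠ 0 by omega), pd_X_ne (show (2 : ℤ) ≠ 0 by omega),
    pd_X_ne (show (0 : ℤ) ≠ 1 by omega), pderiv_inl_gam_self,
    mul_zero, zero_mul, add_zero, zero_add, mul_one] at s1
  simp only [map_mul, map_add, map_pow, map_natCast, shift_C, shift_X_inl,
    shift_gam, shift_cub, show (0 : ℤ) + 1 = 1 by omega, show (1 : ℤ) + 1 = 2 by omega,
    show (2 : ℤ) + 1 = 3 by omega] at s1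
  have hA1 : pderiv (Sum.inl 2) (a 1) = C c * (gam 1 * (6 * cub (X (Sum.inl 0)) (X (Sum.inl 1))
      + (6 * X (Sum.inl 0) * X (Sum.inl 1) - 3 * X (Sum.inl 0) ^ 2) * gam 1)) := by
    apply mul_left_cancel₀ (cub_inl_ne_zero (show (3 : ℤ) ≠ 2 by omega))
    push_cast at s1
    linear_combination -s1
  -- integrate: `a_1` is forced
  have ha1 : a 1 = C c * (cub (X (Sum.inl 0)) (X (Sum.inl 1))
      * (6 * X (Sum.inl 1) * X (Sum.inl 2) - 3 * X (Sum.inl 2) ^ 2)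
      + (2 * X (Sum.inl 0) * X (Sum.inl 1) - X (Sum.inl 0) ^ 2)
      * (3 * X (Sum.inl 1) ^ 2 * X (Sum.inl 2) - 3 * X (Sum.inl 1) * X (Sum.inl 2) ^ 2
        + X (Sum.inl 2) ^ 3)) := by
    apply eq_of_pderiv_eq_of_killVar_eq (v := Sum.inl 2)
    · rw [hA1]
      simp only [pderiv_mul, pderiv_C, map_add, map_sub, pderiv_pow, pd_cub, pderiv_X_self,
        pd_X_ne (show (0 : ℤ) ≠ 2 by omega), pd_X_ne (show (1 : ℤ) ≠ 2 by omega), pderiv_ofNat,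
        mul_zero, zero_mul, add_zero, zero_add, mul_one, sub_zero, gam,
        show (1 : ℤ) + 1 = 2 by omega]
      push_cast
      ring
    · rw [hkill 1 (by norm_num)]
      simp only [map_mul, map_add, map_sub, map_pow, map_ofNat, cub, killVar_C, killVar_X_self,
        killVar_X_of_ne (show (Sum.inl 0 : Var) ≠ Sum.inl 2 by decide),
        killVar_X_of_ne (show (Sum.inl 1 : Var) ≠ Sum.inl 2 by decide)]
      ring
  -- the clash `(★)_2`
  have s2 := hstar 2
  simp only [show (2 : ℤ) - 1 = 1 by omega, show (2 : ℤ) + 1 = 3 by omega, ha1, l0, l2] at s2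
  simp only [pderiv_mul, pderiv_C, map_neg, map_add, map_sub, pderiv_pow, pd_cub, pderiv_ofNat,
    pderiv_X_self, pd_X_ne (show (1 : ℤ) ≠ 0 by omega), pd_X_ne (show (2 : ℤ) ≠ 0 by omega),
    pd_X_ne (show (2 : ℤ) ≠ 1 by omega),
    pd_X_ne (show (0 : ℤ) ≠ 2 by omega), pd_X_ne (show (1 : ℤ) ≠ 2 by omega),
    pd_gam_succ (show (1 : ℤ) = 0 + 1 by omega), pd_gam_succ (show (2 : ℤ) = 1 + 1 by omega),
    mul_zero, zero_mul, add_zero, zero_add, mul_one, sub_zero] at s2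
  simp only [map_mul, map_add, map_sub, map_neg, map_pow, map_ofNat, map_natCast, map_one,
    shift_C, shift_X_inl, gam, cub, show (0 : ℤ) + 1 = 1 by omega,
    show (1 : ℤ) + 1 = 2 by omega, show (2 : ℤ) + 1 = 3 by omega] at s2
  have key : C c * (4 * (cub (X (Sum.inl 0)) (X (Sum.inl 1)) * gam 1 * X (Sum.inl 3)
      * clashQuad 2)) = 0 := by
    simp only [cub, gam, clashQuad, show (1 : ℤ) + 1 = 2 by omega, show (2 : ℤ) - 1 = 1 by omega,
      show (2 : ℤ) + 1 = 3 by omega]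
    push_cast at s2
    linear_combination s2
  have hne : 4 * (cub (X (Sum.inl 0)) (X (Sum.inl 1)) * gam 1 * X (Sum.inl 3) * clashQuad 2)
      ≠ 0 :=
    mul_ne_zero (by norm_num) (mul_ne_zero (mul_ne_zero (mul_ne_zero (cub_inl_ne_zero (by omega))
      (gam_ne_zero 1)) (X_ne_zero _)) (clashQuad_ne_zero 2))
  simpa using (mul_eq_zero.mp key).resolve_right hne

/-! ### Span three -/

/-- `prodsq (Ico 0 2) = γ_0² γ_1²`. [folklore] -/
private theorem prodsq_02 : prodsq (Finset.Ico 0 2) = gam 0 ^ 2 * gam 1 ^ 2 := by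
  rw [prodsq_Ico_bot (show (0 : ℤ) < 2 by omega), zero_add, prodsq_12]

/-- `prodsq (Ico 1 3) = γ_1² γ_2²`. [folklore] -/
private theorem prodsq_13 : prodsq (Finset.Ico 1 3) = gam 1 ^ 2 * gam 2 ^ 2 := by
  have h := prodsq_Ico_succ (show (1 : ℤ) ≤ 2 by omega)
  norm_num at h
  rw [prodsq_12] at h
  exact h

/-- Span `D = 3`: `(★)_1`, `(★)_2` and the boundary conditions force `a_1`, `a_2`, then `(★)_3`
fails unless `c = 0` (residual `6c·Φ_L·γ_2·γ_1²·q_4·clashQuad 3`). [folklore] -/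
theorem core_clash_three : ∀ (c : ℝ) (a : ℤ → R),
    (∀ y, a y ∈ supported ℝ (Sum.inl '' Set.Icc (0 : ℤ) 3)) → (∀ y, y < 0 ∨ 3 < y → a y = 0) →
    a 0 = C c * lead0 3 → a 3 = C c * leadD 3 →
    (∀ y : ℤ, cub (X (Sum.inl 0)) (X (Sum.inl 1)) * shift (pderiv (Sum.inl 0) (a (y - 1))
      + pderiv (Sum.inl (y - 1)) (a 0)) = cub (X (Sum.inl (3 + 1))) (X (Sum.inl 3))
      * (pderiv (Sum.inl 3) (a y) + pderiv (Sum.inl y) (a 3))) →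
    (∀ y, y ≤ 3 - 1 → killVar (Sum.inl 3) (a y) = 0) → c = 0 := by
  intro c a _ _ h0 h3 hstar hkill
  have l0 : a 0 = C c * (cub (X (Sum.inl 3)) (X (Sum.inl 2)) * (gam 0 ^ 2 * gam 1 ^ 2)) := by
    rw [h0, lead0]
    simp only [show (3 : ℤ) - 1 = 2 by omega, prodsq_02]
  have l3 : a 3 = C c * -(cub (X (Sum.inl 0)) (X (Sum.inl 1)) * (gam 1 ^ 2 * gam 2 ^ 2)) := by
    rw [h3, leadD, prodsq_13]
  -- step 1: `(★)_1` and the boundary condition force `a_1`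
  have s1 := hstar 1
  simp only [sub_self, show (3 : ℤ) + 1 = 4 by omega, l0, l3] at s1
  simp only [pderiv_mul, pderiv_C, map_neg, pderiv_pow, pd_cub, pderiv_X_self,
    pd_X_ne (show (3 : ℤ) ≠ 0 by omega), pd_X_ne (show (2 : ℤ) ≠ 0 by omega),
    pd_X_ne (show (0 : ℤ) ≠ 1 by omega), pderiv_inl_gam_self,
    pd_gam_ne (show (1 : ℤ) ≠ 0 by omega) (show (1 : ℤ) + 1 ≠ 0 by omega),
    pd_gam_ne (show (2 : ℤ) ≠ 1 by omega) (show (2 : ℤ) + 1 ≠ 1 by omega),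
    mul_zero, zero_mul, add_zero, zero_add, mul_one] at s1
  simp only [map_mul, map_add, map_pow, map_natCast, shift_C, shift_X_inl,
    shift_gam, shift_cub, show (0 : ℤ) + 1 = 1 by omega, show (1 : ℤ) + 1 = 2 by omega,
    show (2 : ℤ) + 1 = 3 by omega, show (3 : ℤ) + 1 = 4 by omega] at s1
  have hA1 : pderiv (Sum.inl 3) (a 1) = C c * (gam 1 * gam 2 ^ 2
      * (6 * cub (X (Sum.inl 0)) (X (Sum.inl 1))
        + (6 * X (Sum.inl 0) * X (Sum.inl 1) - 3 * X (Sum.inl 0) ^ 2) * gam 1)) := by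
    apply mul_left_cancel₀ (cub_inl_ne_zero (show (4 : ℤ) ≠ 3 by omega))
    push_cast at s1
    linear_combination -s1
  have ha1 : a 1 = C c * (cub (X (Sum.inl 3)) (X (Sum.inl 2)) * gam 1
      * (2 * cub (X (Sum.inl 0)) (X (Sum.inl 1))
        + (2 * X (Sum.inl 0) * X (Sum.inl 1) - X (Sum.inl 0) ^ 2) * gam 1)) := by
    apply eq_of_pderiv_eq_of_killVar_eq (v := Sum.inl 3)
    · rw [hA1]
      simp only [pderiv_mul, pderiv_C, map_add, map_sub, pderiv_pow, pd_cub, pderiv_X_self,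
        pd_X_ne (show (0 : ℤ) ≠ 3 by omega), pd_X_ne (show (1 : ℤ) ≠ 3 by omega),
        pd_X_ne (show (2 : ℤ) ≠ 3 by omega), pderiv_ofNat,
        mul_zero, zero_mul, add_zero, zero_add, mul_one, sub_zero, gam,
        show (1 : ℤ) + 1 = 2 by omega, show (2 : ℤ) + 1 = 3 by omega]
      ring
    · rw [hkill 1 (by norm_num)]
      simp only [map_mul, map_add, map_sub, map_pow, map_ofNat, cub, gam, killVar_C,
        killVar_X_self, killVar_X_of_ne (show (Sum.inl 0 : Var) ≠ Sum.inl 3 by decide),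
        killVar_X_of_ne (show (Sum.inl 1 : Var) ≠ Sum.inl 3 by decide),
        killVar_X_of_ne (show (Sum.inl 2 : Var) ≠ Sum.inl 3 by decide),
        show (1 : ℤ) + 1 = 2 by omega]
      ring
  -- step 2: `(★)_2` and the boundary condition force `a_2`
  have s2 := hstar 2
  simp only [show (2 : ℤ) - 1 = 1 by omega, show (3 : ℤ) + 1 = 4 by omega, ha1, l0, l3] at s2
  simp only [pderiv_mul, pderiv_C, map_neg, map_add, map_sub, pderiv_pow, pd_cub, pderiv_ofNat,
    pderiv_X_self, pd_X_ne (show (1 : ℤ) ≠ 0 by omega), pd_X_ne (show (2 : ℤ) ≠ 0 by omega),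
    pd_X_ne (show (3 : ℤ) ≠ 0 by omega), pd_X_ne (show (3 : ℤ) ≠ 1 by omega),
    pd_X_ne (show (2 : ℤ) ≠ 1 by omega), pd_X_ne (show (0 : ℤ) ≠ 2 by omega),
    pd_X_ne (show (1 : ℤ) ≠ 2 by omega),
    pd_gam_ne (show (1 : ℤ) ≠ 0 by omega) (show (1 : ℤ) + 1 ≠ 0 by omega),
    pd_gam_succ (show (1 : ℤ) = 0 + 1 by omega), pd_gam_succ (show (2 : ℤ) = 1 + 1 by omega),
    pderiv_inl_gam_self, mul_zero, zero_mul, add_zero, zero_add, mul_one] at s2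
  simp only [map_mul, map_add, map_sub, map_neg, map_pow, map_ofNat, map_natCast, map_one,
    shift_C, shift_X_inl, shift_gam, shift_cub, show (0 : ℤ) + 1 = 1 by omega,
    show (1 : ℤ) + 1 = 2 by omega, show (2 : ℤ) + 1 = 3 by omega,
    show (3 : ℤ) + 1 = 4 by omega] at s2
  have hA2 : pderiv (Sum.inl 3) (a 2) = C c * (cub (X (Sum.inl 0)) (X (Sum.inl 1)) * gam 1
      * gam 2 * (10 * gam 1 - 6 * gam 2)) := by
    apply mul_left_cancel₀ (cub_inl_ne_zero (show (4 : ℤ) ≠ 3 by omega))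
    simp only [gam, show (1 : ℤ) + 1 = 2 by omega, show (2 : ℤ) + 1 = 3 by omega] at s2 ⊢
    push_cast at s2
    linear_combination -s2
  have ha2 : a 2 = C c * (cub (X (Sum.inl 0)) (X (Sum.inl 1)) * gam 1
      * (10 * gam 1 * X (Sum.inl 2) * X (Sum.inl 3) - 5 * gam 1 * X (Sum.inl 3) ^ 2
        - 6 * X (Sum.inl 2) ^ 2 * X (Sum.inl 3) + 6 * X (Sum.inl 2) * X (Sum.inl 3) ^ 2
        - 2 * X (Sum.inl 3) ^ 3)) := by
    apply eq_of_pderiv_eq_of_killVar_eq (v := Sum.inl 3)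
    · rw [hA2]
      simp only [pderiv_mul, pderiv_C, map_add, map_sub, pderiv_pow, pd_cub, pderiv_X_self,
        pd_X_ne (show (0 : ℤ) ≠ 3 by omega), pd_X_ne (show (1 : ℤ) ≠ 3 by omega),
        pd_X_ne (show (2 : ℤ) ≠ 3 by omega), pderiv_ofNat,
        mul_zero, zero_mul, add_zero, zero_add, mul_one, sub_zero, gam,
        show (1 : ℤ) + 1 = 2 by omega, show (2 : ℤ) + 1 = 3 by omega]
      push_cast
      ring
    · rw [hkill 2 (by norm_num)]
      simp only [map_mul, map_add, map_sub, map_pow, map_ofNat, cub, gam, killVar_C,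
        killVar_X_self, killVar_X_of_ne (show (Sum.inl 0 : Var) ≠ Sum.inl 3 by decide),
        killVar_X_of_ne (show (Sum.inl 1 : Var) ≠ Sum.inl 3 by decide),
        killVar_X_of_ne (show (Sum.inl 2 : Var) ≠ Sum.inl 3 by decide),
        show (1 : ℤ) + 1 = 2 by omega]
      ring
  -- step 3: the clash `(★)_3`
  have s3 := hstar 3
  simp only [show (3 : ℤ) - 1 = 2 by omega, show (3 : ℤ) + 1 = 4 by omega, ha2, l0, l3] at s3
  simp only [pderiv_mul, pderiv_C, map_neg, map_add, map_sub, pderiv_pow, pd_cub, pderiv_ofNat,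
    pderiv_X_self, pd_X_ne (show (1 : ℤ) ≠ 0 by omega), pd_X_ne (show (2 : ℤ) ≠ 0 by omega),
    pd_X_ne (show (3 : ℤ) ≠ 0 by omega), pd_X_ne (show (3 : ℤ) ≠ 2 by omega),
    pd_X_ne (show (0 : ℤ) ≠ 3 by omega), pd_X_ne (show (1 : ℤ) ≠ 3 by omega),
    pd_gam_ne (show (1 : ℤ) ≠ 0 by omega) (show (1 : ℤ) + 1 ≠ 0 by omega),
    pd_gam_ne (show (0 : ℤ) ≠ 2 by omega) (show (0 : ℤ) + 1 ≠ 2 by omega),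
    pd_gam_ne (show (1 : ℤ) ≠ 3 by omega) (show (1 : ℤ) + 1 ≠ 3 by omega),
    pd_gam_succ (show (2 : ℤ) = 1 + 1 by omega), pd_gam_succ (show (3 : ℤ) = 2 + 1 by omega),
    mul_zero, zero_mul, add_zero, zero_add, mul_one, sub_zero] at s3
  simp only [map_mul, map_add, map_sub, map_neg, map_pow, map_ofNat, map_natCast, map_one,
    shift_C, shift_X_inl, gam, cub, show (0 : ℤ) + 1 = 1 by omega,
    show (1 : ℤ) + 1 = 2 by omega, show (2 : ℤ) + 1 = 3 by omega,
    show (3 : ℤ) + 1 = 4 by omega] at s3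
  have key : C c * (6 * (cub (X (Sum.inl 0)) (X (Sum.inl 1)) * gam 2 * gam 1 ^ 2 * X (Sum.inl 4)
      * clashQuad 3)) = 0 := by
    simp only [cub, gam, clashQuad, show (1 : ℤ) + 1 = 2 by omega, show (2 : ℤ) + 1 = 3 by omega,
      show (3 : ℤ) - 1 = 2 by omega, show (3 : ℤ) + 1 = 4 by omega]
    push_cast at s3
    linear_combination s3
  have hne : 6 * (cub (X (Sum.inl 0)) (X (Sum.inl 1)) * gam 2 * gam 1 ^ 2 * X (Sum.inl 4)
      * clashQuad 3) ≠ 0 :=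
    mul_ne_zero (by norm_num) (mul_ne_zero (mul_ne_zero (mul_ne_zero (mul_ne_zero
      (cub_inl_ne_zero (by omega)) (gam_ne_zero 2)) (pow_ne_zero 2 (gam_ne_zero 1))) (X_ne_zero _))
      (clashQuad_ne_zero 3))
  simpa using (mul_eq_zero.mp key).resolve_right hne

/-! ### Assembly: the core clash for every span `D ≥ 1` -/

/-- **CORE CLASH.** For every span `D ≥ 1`: if the end coefficients have the forced closed forms
`a_0 = c·lead0 D`, `a_D = c·leadD D`, all transport equations `(★)_y` hold and every `a_y`
(`y ≤ D-1`) vanishes on `q_D = 0`, then `c = 0`.  Small spans `D ≤ 3` are explicit; for `D ≥ 4`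
the recursion `core_step_one/two/generic/last` forces `a_1, …, a_{D-1}` and `core_clash_of_last`
exhibits the nonzero residual of `(★)_D`. [folklore] -/
theorem core_clash : ∀ {D : ℤ}, 1 ≤ D → ∀ (c : ℝ) (a : ℤ → R),
    (∀ y, a y ∈ supported ℝ (Sum.inl '' Set.Icc (0 : ℤ) D)) → (∀ y, y < 0 ∨ D < y → a y = 0) →
    a 0 = C c * lead0 D → a D = C c * leadD D →
    (∀ y : ℤ, cub (X (Sum.inl 0)) (X (Sum.inl 1)) * shift (pderiv (Sum.inl 0) (a (y - 1))
      + pderiv (Sum.inl (y - 1)) (a 0)) = cub (X (Sum.inl (D + 1))) (X (Sum.inl D))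
      * (pderiv (Sum.inl D) (a y) + pderiv (Sum.inl y) (a D))) →
    (∀ y, y ≤ D - 1 → killVar (Sum.inl D) (a y) = 0) → c = 0 := by
  intro D hD1 c a hsupp hzero h0 hDD hstar hkill
  rcases (show D = 1 ∨ D = 2 ∨ D = 3 ∨ 4 ≤ D by omega) with rfl | rfl | rfl | hD4
  · exact core_clash_one c a hsupp hzero h0 hDD hstar hkill
  · exact core_clash_two c a hsupp hzero h0 hDD hstar hkill
  · exact core_clash_three c a hsupp hzero h0 hDD hstar hkill
  -- `D ≥ 4`: run the transport recursion, then clash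
  have h1 : a 1 = C c * lead1 D := by
    refine core_step_one c a (by omega) hsupp h0 hDD ?_ (hkill 1 (by omega))
    have key := hstar 1
    rwa [sub_self] at key
  have h2 : a 2 = C c * leadMid D 2 := by
    refine core_step_two c a hD4 hsupp h0 hDD h1 ?_ (hkill 2 (by omega))
    have key := hstar 2
    simp only [show (2 : ℤ) - 1 = 1 by omega] at key
    exact key
  have hmid : ∀ n : ℕ, (n : ℤ) + 2 ≤ D - 2 → a ((n : ℤ) + 2) = C c * leadMid D ((n : ℤ) + 2) := by
    intro n
    induction n with
    | zero =>
      intro _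
      simpa using h2
    | succ n ih =>
      intro hn
      push_cast at hn ⊢
      refine core_step_generic c a ((n : ℤ) + 1 + 2) (by omega) (by omega) hsupp h0 hDD ?_
        (hstar _) (hkill _ (by omega))
      rw [show (n : ℤ) + 1 + 2 - 1 = (n : ℤ) + 2 by ring]
      exact ih (by omega)
  have hDm2 : a (D - 2) = C c * leadMid D (D - 2) := by
    have key := hmid (D - 4).toNat (by omega)
    rwa [show ((D - 4).toNat : ℤ) + 2 = D - 2 by omega] at key
  have hlast : a (D - 1) = C c * leadLast D := by
    refine core_step_last c a hD4 hsupp h0 hDD hDm2 ?_ (hkill (D - 1) (by omega))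
    have key := hstar (D - 1)
    rwa [show D - 1 - 1 = D - 2 by ring] at key
  exact core_clash_of_last c a hD4 h0 hDD hlast (hstar D)

end Summit.AtomisticToContinuum.FouriersLaw.Theorems.OddChargeAlgebra

end
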